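import Mathlib
import Literature.MathematicalPhysics.QuantumFieldTheory.Balaban1983to89.B9Eq39Adjoint
import Literature.MathematicalPhysics.QuantumFieldTheory.Balaban1983to89.B11Eq37NormBound

/-!
# `Balaban1983to89.B11Eq92ByParts` — T. Bałaban, *The variational problem and background fields in renormalization group method for
# lattice gauge theories*, Commun. Math. Phys. **102** (1985) 277–309 [Balaban1985Variational], p. 292 [PDF 16]: **(91) → (92) → (93)** —
# the functional differentiation of the typical term `½⟨DA′, Σi[A″, A″]⟩` (91) INTO ITS THREE TERMS (92), EXACTLY, and the
# INTEGRATION BY PARTS of its first term giving «the functional derivative ½D*Σi[A″, A″]» (93), on the finite lattice of [5] (3.1)–(3.12)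
# (`B9Eq39Adjoint`: sites `S`, directions `ι`, bijective shifts `T`, exact background `U`, tracial `τ` in the rôle of `tr`)

statement-level skeleton of published theorems with citation tags; proofs where landed; nothing here is a claim about the Yang–Mills mass gap

PDF held: `paper:balaban1985-cmp102-variational-background` (journal page = PDF page + 276); p. 292 [PDF 16] read by this seat from the
`lit read` text layer (2026-08-21), displays (91)–(93) as transcribed (render-read) in `B11Eq93Commutator` (gen 2).

CITATION HEADER (lean-in-tree rule 2026-08-18).  WHAT IS REPRODUCED: SKELETON row **B11.Eq85** (reader r08 `ROWS-B11.md`: the termwise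
estimates (85)–(96) of `(δ/δA′)V`, head `typed`; its cell lists as «still NOT typed: … (92)→(93) integration by parts») — the passage of
p. 292, verbatim: *«Let us consider the terms with the derivative acting on A′. A typical term is Σ_{p∈Ω₀} η^d ½ tr(DA′)(p) Σ_{b₁≺b₂}
i[A″(b₁), A″(b₂)] = ½⟨DA′, Σi[A″, A″]⟩, (91) the other terms are obtained by replacing some A′ in the commutator by −HD(A′). The
functional differentiation gives three terms ½⟨DδA′, Σi[A″, A″]⟩ + ½⟨DA′, Σi([δA″, A″] + [A″, δA″])⟩, (92) and the functional
derivatives connected with the second and third terms are estimated easily by O(1)|DA′||A′|. We transform the first term integrating by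
parts, and we get the functional derivative given by ½D*Σi[A″, A″]. (93)»*  Functional derivatives are kernels w.r.t. the bond
pairing `⟨δA′, K⟩` ((63) p. 287: *«⟨(δ/δA′)D(A′), δA′⟩ = (d/dτ)D(A′ + τδA′)|_{τ=0}»*); `D` on bond functions is (3.4) of [5] =
`B9Eq39Adjoint.curlη`, `D*` on plaquette functions is (3.9) of [5] = `B9Eq39Adjoint.divPη`, `⟨A, E⟩ = Σ_b η^d tr A(b)E(b)` is (3.11) =
`B9Eq39Adjoint.bondPair`; «A″» are the transported letters `A′(b)`, `b ⊂ ∂(p)_z`, of [5] (3.2) = `B9Eq39Adjoint.lettersA` (p. 292: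
*«the “primes” in this expression … are connected with an application of the operators R(U₀). Now we denote the corresponding
expressions by A″ instead of A′»*), and `Σ_{b₁≺b₂}[·, ·]` over the four letters is `B11Eq34BCH.comm2` ((34)/(39)).
[5] = T. Bałaban, CMP **99** (1985) 389–434 [Balaban1985BackgroundPropagators].

WHAT IS CERTIFIED (kernel, sorry-free; axioms `propext` / `Classical.choice` / `Quot.sound`).  Carrier of `B9Eq39Adjoint` (exact background,
any complete normed `ℂ`-algebra `𝔸`, continuous `τ : 𝔸 →L[ℂ] ℂ`, tracial where stated).
* §1 the letters and their commutator sums: `icomm A p = Σ_{b₁≺b₂} i[A″(b₁), A″(b₂)]` (= `i·comm2` of the four letters), the POLARISATION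
  `icommD A δ p = Σ_{b₁≺b₂} i([δA″(b₁), A″(b₂)] + [A″(b₁), δA″(b₂)])` (the integrand of the second and third terms of (92)); the algebra
  `comm2_add_smul` (`comm2` of `Y + tZ` = `comm2 Y + t·comm2pol Y Z + t²·comm2 Z`), `icomm_add_smul`, `curlη_add_smul` (letters and `D` are
  linear in `A′`).
* §2 the pairings: `plaqPair η d τ F G = Σ_{p} η^d τ(F(p)G(p))` over positively oriented plaquettes, **(91)** `T91 η d τ A = ½·plaqPair (DA′)
  (icomm A′)` with `eq91` (the printed plaquette sum), `summand91_eq_term39` (its summand IS the first term of (39) in the spelling of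
  `B11Eq36Complex`/`B11Eq37NormBound.V3_split39`).
* §3 **(92) EXACTLY**: `hasDerivAt_T91` — `(d/dt) T91(A′ + tδA′)|_{t=0} = ½·plaqPair (DδA′) (icomm A′) + ½·plaqPair (DA′) (icommD A′ δA′)` —
  «The functional differentiation gives three terms» (product rule for `t ↦ τ(D(A′+tδA′)(p)·icomm(A′+tδA′)(p))` in the normed algebra).
* §4 **(92) → (93), THE INTEGRATION BY PARTS**: `fd93 η A = ½D*Σi[A″, A″] := divPη (½·icomm A)` and **`byParts_92_93`**:
  `½·plaqPair (DδA′) (icomm A′) = ⟨δA′, fd93 A′⟩` — [5] (3.9) `B9Eq39Adjoint.bondPair_divPη` at `F = ½Σi[A″, A″]`; assembled: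
  **`hasDerivAt_T91_byParts`** — `(d/dt) T91(A′ + tδA′)|₀ = ⟨δA′, ½D*Σi[A″, A″]⟩ + ½⟨DA′, Σi([δA″, A″] + [A″, δA″])⟩`.
* §5 «estimated easily by O(1)|DA′||A′|»: `norm_icommD_le` (`‖icommD‖ ≤ 24·a·Δ` from letter bounds `‖A″‖ ≤ a`, `‖δA″‖ ≤ Δ`) and
  `norm_summand92_le` (the second-plus-third-term summand per plaquette `‖½τ((DA′)(p)·icommD(p))‖ ≤ 12‖τ‖·G·a·Δ` for `‖(DA′)(p)‖ ≤ G`) — the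
  printed O(1) per plaquette explicit as `12‖τ‖`.

MODEL / DECLARED READINGS.  (M1) The finite set of sites `S` with bijective shifts (torus) replaces print's `Ω₀ ⊂ T_η`; boundary
localisation to `Ω_j` is the reader's (as in `B11Eq93Commutator` (iii)).  (M2) The row's gen-2 kernel `B11Eq93Commutator` lives on the
cell's OTHER carrier (`ℤᵈ` of `B8Eq151V2Divergence`, where (93)–(96) and their O(1) are certified); THIS file supplies, on the carrier where
the by-parts identity (3.9) is a theorem (`B9Eq39Adjoint.sum_curl_mul`), the two steps that module lists as NOT typed: (92) and (92) → (93).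
The two carriers are not bridged here (DIVERGENCE noted; both are models of the same printed lattice).  (M3) `τ` continuous ℂ-linear and
tracial stands for the normalised trace; `𝔸` any complete normed ℂ-algebra (𝔤ᶜ ⊆ M_N(ℂ) in print).

HONEST SCOPE — what is NOT claimed.  «the other terms … obtained by replacing some A′ in the commutator by −HD(A′)» (they need the Sect. C
operators); the O(1)-estimate as a KERNEL bound summed over `st(b)` (only the per-plaquette bound is given; `#st(b) ≤ 2(d − 1)` is
`B11Eq90StB.card_st_le` on this carrier's plaquette set); (93)–(96) themselves (row kernel `B11Eq93Commutator`, ℤᵈ carrier).  No new named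
fact: `icomm`, `icommD`, `comm2pol`, `plaqPair`, `T91`, `fd93` are definitions with bodies, everything else is a theorem.  Mega-formalization
`lit-balaban`, HOME `run/shared/lean/pub/lit-balaban/`, reader/typer seat r08 gen 9 (unit `lit-balaban-r08`, B11 fold owner).  Imports
`B9Eq39Adjoint`, `B11Eq37NormBound` (for `B11Eq34BCH.comm2` and the commutator norm bounds); modifies nothing there.
-/

noncomputable section

namespace Literature.MathematicalPhysics.QuantumFieldTheory.Balaban1983to89.B11Eq92ByParts

open Complex Finset
open Literature.MathematicalPhysics.QuantumFieldTheory.Balaban1983to89.B9Eq39Adjoint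
open Literature.MathematicalPhysics.QuantumFieldTheory.Balaban1983to89.B11Eq34BCH (comm2)
open Literature.MathematicalPhysics.QuantumFieldTheory.Balaban1983to89.B11Eq37NormBound (norm_lie_le_of_le)

/-! ## §1 The letters `A″(b)`, the commutator sum `Σ_{b₁≺b₂} i[A″(b₁), A″(b₂)]` and its polarisation -/

section Letters

variable {𝔸 : Type*} [Ring 𝔸] [Algebra ℂ 𝔸] {S : Type*} {ι : Type*}
variable (T : ι → Equiv.Perm S) (U : ι → S → 𝔸ˣ)

/-- The POLARISED commutator sum `Σ_{i<j} ([Zᵢ, Yⱼ] + [Yᵢ, Zⱼ])` of two quadruples of letters — the integrand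
`Σ_{b₁≺b₂}([δA″(b₁), A″(b₂)] + [A″(b₁), δA″(b₂)])` of the second and third terms of (92) (with `Y = A″`, `Z = δA″`).
[cite: Balaban1985Variational, (92) p.292] -/
def comm2pol (Y₁ Y₂ Y₃ Y₄ Z₁ Z₂ Z₃ Z₄ : 𝔸) : 𝔸 :=
  (⁅Z₁, Y₂⁆ + ⁅Y₁, Z₂⁆) + (⁅Z₁, Y₃⁆ + ⁅Y₁, Z₃⁆) + (⁅Z₁, Y₄⁆ + ⁅Y₁, Z₄⁆) +
    (⁅Z₂, Y₃⁆ + ⁅Y₂, Z₃⁆) + (⁅Z₂, Y₄⁆ + ⁅Y₂, Z₄⁆) + (⁅Z₃, Y₄⁆ + ⁅Y₃, Z₄⁆)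

/-- **Bilinearity of `Σ_{b₁≺b₂}[·, ·]`**: `comm2 (Y + tZ) = comm2 Y + t·comm2pol Y Z + t²·comm2 Z` — the expansion behind «The functional
differentiation gives three terms». [cite: Balaban1985Variational, (92) p.292] -/
theorem comm2_add_smul (t : ℂ) (Y₁ Y₂ Y₃ Y₄ Z₁ Z₂ Z₃ Z₄ : 𝔸) :
    comm2 (Y₁ + t • Z₁) (Y₂ + t • Z₂) (Y₃ + t • Z₃) (Y₄ + t • Z₄) =
      comm2 Y₁ Y₂ Y₃ Y₄ + t • comm2pol Y₁ Y₂ Y₃ Y₄ Z₁ Z₂ Z₃ Z₄ + t ^ 2 • comm2 Z₁ Z₂ Z₃ Z₄ := by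
  simp only [comm2, comm2pol, Ring.lie_def, mul_add, add_mul, smul_mul_assoc, mul_smul_comm]
  module

/-- The four transported letters `A″(b)`, `b ⊂ ∂(p)_z`, of the plaquette `p_{μν}(x)` — the entries of `B9Eq39Adjoint.lettersA`, as a
function `Fin 4`-free quadruple (ℓ₁, ℓ₂, ℓ₃, ℓ₄). [cite: Balaban1985Variational, p.292; Balaban1985BackgroundPropagators, (3.2) p.390] -/
def ℓ₁ (A : ι → S → 𝔸) (μ ν : ι) (x : S) : 𝔸 := -(R (U ν x) (A μ (T ν x)))
/-- Second letter `A″(w, x) = −A_ν(x)`. [cite: Balaban1985BackgroundPropagators, (3.2) p.390] -/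
def ℓ₂ (A : ι → S → 𝔸) (_μ ν : ι) (x : S) : 𝔸 := -(A ν x)
/-- Third letter `A″(x, y) = A_μ(x)`. [cite: Balaban1985BackgroundPropagators, (3.2) p.390] -/
def ℓ₃ (A : ι → S → 𝔸) (μ _ν : ι) (x : S) : 𝔸 := A μ x
/-- Fourth letter `A″(y, z) = R(U(x, y))A_ν(y)`. [cite: Balaban1985BackgroundPropagators, (3.2) p.390] -/
def ℓ₄ (A : ι → S → 𝔸) (μ ν : ι) (x : S) : 𝔸 := R (U μ x) (A ν (T μ x))

omit [Algebra ℂ 𝔸] in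
/-- The letters ARE `lettersA`. [cite: Balaban1985BackgroundPropagators, (3.2) p.390] -/
theorem lettersA_eq (A : ι → S → 𝔸) (μ ν : ι) (x : S) :
    lettersA T U A μ ν x = [ℓ₁ T U A μ ν x, ℓ₂ A μ ν x, ℓ₃ A μ ν x, ℓ₄ T U A μ ν x] := rfl

/-- The letters are LINEAR in the field: `A″(A′ + tδA′) = A″(A′) + t·A″(δA′)`. [cite: Balaban1985Variational, (92) p.292] -/
theorem letters_add_smul (A δ : ι → S → 𝔸) (t : ℂ) (μ ν : ι) (x : S) :
    ℓ₁ T U (A + t • δ) μ ν x = ℓ₁ T U A μ ν x + t • ℓ₁ T U δ μ ν x ∧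
    ℓ₂ (A + t • δ) μ ν x = ℓ₂ A μ ν x + t • ℓ₂ δ μ ν x ∧
    ℓ₃ (A + t • δ) μ ν x = ℓ₃ A μ ν x + t • ℓ₃ δ μ ν x ∧
    ℓ₄ T U (A + t • δ) μ ν x = ℓ₄ T U A μ ν x + t • ℓ₄ T U δ μ ν x := by
  refine ⟨?_, ?_, rfl, ?_⟩
  · simp only [ℓ₁, Pi.add_apply, Pi.smul_apply, R_add, R_smul, neg_add, smul_neg]
  · simp only [ℓ₂, Pi.add_apply, Pi.smul_apply, neg_add, smul_neg]
  · simp only [ℓ₄, Pi.add_apply, Pi.smul_apply, R_add, R_smul]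

/-- **`Σ_{b₁≺b₂} i[A″(b₁), A″(b₂)]`** for the plaquette `p_{μν}(x)` — the commutator sum of (39)/(91) WITH its factor `i`.
[cite: Balaban1985Variational, (91) p.292, (39) p.284] -/
def icomm (A : ι → S → 𝔸) (μ ν : ι) (x : S) : 𝔸 :=
  (I : ℂ) • comm2 (ℓ₁ T U A μ ν x) (ℓ₂ A μ ν x) (ℓ₃ A μ ν x) (ℓ₄ T U A μ ν x)

/-- **`Σ_{b₁≺b₂} i([δA″(b₁), A″(b₂)] + [A″(b₁), δA″(b₂)])`** — the integrand of the second and third terms of (92).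
[cite: Balaban1985Variational, (92) p.292] -/
def icommD (A δ : ι → S → 𝔸) (μ ν : ι) (x : S) : 𝔸 :=
  (I : ℂ) • comm2pol (ℓ₁ T U A μ ν x) (ℓ₂ A μ ν x) (ℓ₃ A μ ν x) (ℓ₄ T U A μ ν x)
    (ℓ₁ T U δ μ ν x) (ℓ₂ δ μ ν x) (ℓ₃ δ μ ν x) (ℓ₄ T U δ μ ν x)

/-- **The expansion of the commutator sum along a line**: `icomm(A′ + tδA′) = icomm A′ + t·icommD A′ δA′ + t²·icomm δA′`.
[cite: Balaban1985Variational, (92) p.292] -/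
theorem icomm_add_smul (A δ : ι → S → 𝔸) (t : ℂ) (μ ν : ι) (x : S) :
    icomm T U (A + t • δ) μ ν x = icomm T U A μ ν x + t • icommD T U A δ μ ν x + t ^ 2 • icomm T U δ μ ν x := by
  obtain ⟨h1, h2, h3, h4⟩ := letters_add_smul T U A δ t μ ν x
  rw [icomm, h1, h2, h3, h4, comm2_add_smul, icomm, icommD, icomm, smul_add, smul_add, smul_comm (I : ℂ) t,
    smul_comm (I : ℂ) (t ^ 2)]

/-- **`D` is linear**: `(D(A′ + tδA′))(p) = (DA′)(p) + t·(DδA′)(p)` ((3.4) of [5]). [cite: Balaban1985BackgroundPropagators, (3.4) p.391] -/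
theorem curlη_add_smul (η : ℝ) (A δ : ι → S → 𝔸) (t : ℂ) (μ ν : ι) (x : S) :
    curlη T U η (A + t • δ) μ ν x = curlη T U η A μ ν x + t • curlη T U η δ μ ν x := by
  simp only [curlη, curl, covD, Pi.add_apply, Pi.smul_apply, R_add, R_smul, smul_add, smul_sub]
  module

end Letters

/-! ## §2 The pairings and the typical term (91) -/

section Pairings

variable {𝔸 : Type*} [Ring 𝔸] [Algebra ℂ 𝔸] {S : Type*} [Fintype S] {ι : Type*} [Fintype ι] [LinearOrder ι]
variable (T : ι → Equiv.Perm S) (U : ι → S → 𝔸ˣ)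

/-- The PLAQUETTE pairing `⟨F, G⟩ = Σ_{p⊂T_η} η^d τ(F(p)G(p))` over positively oriented plaquettes (the companion of the bond pairing (3.11)
`B9Eq39Adjoint.bondPair`; in (91)–(92) `⟨DA′, ·⟩` is this with `F = DA′`). [cite: Balaban1985Variational, (91) p.292;
Balaban1985BackgroundPropagators, (3.11) p.392] -/
def plaqPair (η : ℝ) (d : ℕ) (τ : 𝔸 →ₗ[ℂ] ℂ) (F G : ι → ι → S → 𝔸) : ℂ :=
  (η : ℂ) ^ d * ∑ q ∈ posPlaq S ι, τ (F q.2.1 q.2.2 q.1 * G q.2.1 q.2.2 q.1)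

/-- **(91), the typical term**: `T₉₁(A′) = ½⟨DA′, Σi[A″, A″]⟩`. [cite: Balaban1985Variational, (91) p.292] -/
def T91 (η : ℝ) (d : ℕ) (τ : 𝔸 →ₗ[ℂ] ℂ) (A : ι → S → 𝔸) : ℂ :=
  (2 : ℂ)⁻¹ * plaqPair η d τ (curlη T U η A) (icomm T U A)

/-- **(91) as printed**: `T₉₁(A′) = Σ_{p∈Ω₀} η^d ½ tr (DA′)(p) Σ_{b₁≺b₂} i[A″(b₁), A″(b₂)]`. [cite: Balaban1985Variational, (91) p.292] -/
theorem eq91 (η : ℝ) (d : ℕ) (τ : 𝔸 →ₗ[ℂ] ℂ) (A : ι → S → 𝔸) :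
    T91 T U η d τ A = ∑ q ∈ posPlaq S ι,
      (η : ℂ) ^ d * ((2 : ℂ)⁻¹ * τ (curlη T U η A q.2.1 q.2.2 q.1 * icomm T U A q.2.1 q.2.2 q.1)) := by
  rw [T91, plaqPair, Finset.mul_sum, Finset.mul_sum]
  exact Finset.sum_congr rfl fun q _ => by ring

omit [Fintype S] [Fintype ι] [LinearOrder ι] in
/-- The summand of (91) IS the first term of (39) in the spelling of `B11Eq37NormBound.V3_split39` / `B11Eq36Complex`
(`½ i tr((DA)(p) Σ_{b₁≺b₂}[A′(b₁), A′(b₂)])`, with the four letters of `lettersA`). [cite: Balaban1985Variational, (39) p.284, (91) p.292] -/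
theorem summand91_eq_term39 (η : ℝ) (τ : 𝔸 →ₗ[ℂ] ℂ) (A : ι → S → 𝔸) (μ ν : ι) (x : S) :
    (2 : ℂ)⁻¹ * τ (curlη T U η A μ ν x * icomm T U A μ ν x) =
      (2 : ℂ)⁻¹ * I * τ (curlη T U η A μ ν x *
        comm2 (-(R (U ν x) (A μ (T ν x)))) (-(A ν x)) (A μ x) (R (U μ x) (A ν (T μ x)))) := by
  rw [icomm, mul_smul_comm, map_smul, smul_eq_mul, ← mul_assoc]
  rfl

end Pairings

/-! ## §3 (92): the three terms of the functional differentiation, exactly -/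

section Differentiation

variable {𝔸 : Type*} [NormedRing 𝔸] [NormedAlgebra ℂ 𝔸] {S : Type*} [Fintype S] {ι : Type*} [Fintype ι] [LinearOrder ι]
variable (T : ι → Equiv.Perm S) (U : ι → S → 𝔸ˣ)

omit [Fintype S] [Fintype ι] [LinearOrder ι] in
/-- Per plaquette: `(d/dt) τ((D(A′+tδA′))(p)·icomm(A′+tδA′)(p))|₀ = τ((DδA′)(p)·icomm A′(p) + (DA′)(p)·icommD A′ δA′(p))` (product rule;
both factors are polynomials in `t`). [cite: Balaban1985Variational, (92) p.292] -/
theorem hasDerivAt_summand (η : ℝ) (τ : 𝔸 →L[ℂ] ℂ) (A δ : ι → S → 𝔸) (μ ν : ι) (x : S) :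
    HasDerivAt (fun t : ℂ => (τ : 𝔸 →ₗ[ℂ] ℂ) (curlη T U η (A + t • δ) μ ν x * icomm T U (A + t • δ) μ ν x))
      ((τ : 𝔸 →ₗ[ℂ] ℂ) (curlη T U η δ μ ν x * icomm T U A μ ν x + curlη T U η A μ ν x * icommD T U A δ μ ν x)) 0 := by
  -- the two factors along the line
  have hf : HasDerivAt (fun t : ℂ => curlη T U η (A + t • δ) μ ν x) (curlη T U η δ μ ν x) 0 := by
    have h : HasDerivAt (fun t : ℂ => curlη T U η A μ ν x + t • curlη T U η δ μ ν x) ((1 : ℂ) • curlη T U η δ μ ν x) 0 :=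
      ((hasDerivAt_id (0 : ℂ)).smul_const _).const_add _
    rw [one_smul] at h
    refine h.congr_of_eventuallyEq (Filter.Eventually.of_forall fun t => ?_)
    exact curlη_add_smul T U η A δ t μ ν x
  have hg : HasDerivAt (fun t : ℂ => icomm T U (A + t • δ) μ ν x) (icommD T U A δ μ ν x) 0 := by
    have h1 : HasDerivAt (fun t : ℂ => t • icommD T U A δ μ ν x) ((1 : ℂ) • icommD T U A δ μ ν x) 0 :=
      (hasDerivAt_id (0 : ℂ)).smul_const _
    have h2 : HasDerivAt (fun t : ℂ => t ^ 2 • icomm T U δ μ ν x) (((2 : ℕ) * (0 : ℂ) ^ (2 - 1)) • icomm T U δ μ ν x) 0 :=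
      (hasDerivAt_pow 2 (0 : ℂ)).smul_const _
    have h := (h1.const_add (icomm T U A μ ν x)).add h2
    have h' : HasDerivAt (fun t : ℂ => icomm T U A μ ν x + t • icommD T U A δ μ ν x + t ^ 2 • icomm T U δ μ ν x)
        (icommD T U A δ μ ν x) 0 := h.congr_deriv (by simp)
    refine h'.congr_of_eventuallyEq (Filter.Eventually.of_forall fun t => ?_)
    exact icomm_add_smul T U A δ t μ ν x
  have hprod := hf.mul hg
  have hτ := ((τ.hasFDerivAt).comp_hasDerivAt (0 : ℂ) hprod)
  have hval : curlη T U η (A + (0 : ℂ) • δ) μ ν x = curlη T U η A μ ν x := by simp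
  have hval' : icomm T U (A + (0 : ℂ) • δ) μ ν x = icomm T U A μ ν x := by simp
  rw [hval, hval'] at hτ
  simpa [Function.comp_def] using hτ

/-- **(92) EXACTLY** — «The functional differentiation gives three terms ½⟨DδA′, Σi[A″, A″]⟩ + ½⟨DA′, Σi([δA″, A″] + [A″, δA″])⟩»:
`(d/dt) T₉₁(A′ + tδA′)|_{t=0} = ½·plaqPair (DδA′) (icomm A′) + ½·plaqPair (DA′) (icommD A′ δA′)` (the second and third printed terms are the
one polarised pairing). [cite: Balaban1985Variational, (92) p.292, (63) p.287] -/
theorem hasDerivAt_T91 (η : ℝ) (d : ℕ) (τ : 𝔸 →L[ℂ] ℂ) (A δ : ι → S → 𝔸) :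
    HasDerivAt (fun t : ℂ => T91 T U η d (τ : 𝔸 →ₗ[ℂ] ℂ) (A + t • δ))
      ((2 : ℂ)⁻¹ * plaqPair η d (τ : 𝔸 →ₗ[ℂ] ℂ) (curlη T U η δ) (icomm T U A) +
        (2 : ℂ)⁻¹ * plaqPair η d (τ : 𝔸 →ₗ[ℂ] ℂ) (curlη T U η A) (icommD T U A δ)) 0 := by
  have hsum : HasDerivAt (fun t : ℂ => ∑ q ∈ posPlaq S ι,
      (τ : 𝔸 →ₗ[ℂ] ℂ) (curlη T U η (A + t • δ) q.2.1 q.2.2 q.1 * icomm T U (A + t • δ) q.2.1 q.2.2 q.1))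
      (∑ q ∈ posPlaq S ι, (τ : 𝔸 →ₗ[ℂ] ℂ) (curlη T U η δ q.2.1 q.2.2 q.1 * icomm T U A q.2.1 q.2.2 q.1 +
        curlη T U η A q.2.1 q.2.2 q.1 * icommD T U A δ q.2.1 q.2.2 q.1)) 0 :=
    HasDerivAt.fun_sum fun q _ => hasDerivAt_summand T U η τ A δ q.2.1 q.2.2 q.1
  have h := (hsum.const_mul ((η : ℂ) ^ d)).const_mul ((2 : ℂ)⁻¹)
  have hfun : (fun t : ℂ => T91 T U η d (τ : 𝔸 →ₗ[ℂ] ℂ) (A + t • δ)) = fun t : ℂ => (2 : ℂ)⁻¹ * ((η : ℂ) ^ d *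
      ∑ q ∈ posPlaq S ι, (τ : 𝔸 →ₗ[ℂ] ℂ) (curlη T U η (A + t • δ) q.2.1 q.2.2 q.1 * icomm T U (A + t • δ) q.2.1 q.2.2 q.1)) := by
    funext t; rfl
  rw [hfun]
  refine h.congr_deriv ?_
  simp only [plaqPair, map_add, Finset.sum_add_distrib, mul_add]

end Differentiation

/-! ## §4 (92) → (93): the first term integrated by parts -/

section ByParts

variable {𝔸 : Type*} [Ring 𝔸] [Algebra ℂ 𝔸] {S : Type*} [Fintype S] {ι : Type*} [Fintype ι] [LinearOrder ι]
variable (T : ι → Equiv.Perm S) (U : ι → S → 𝔸ˣ)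

/-- **(93) — «the functional derivative given by ½D*Σi[A″, A″]»**: the plaquette-to-bond adjoint `D*` of [5] (3.9) (`B9Eq39Adjoint.divPη`)
applied to the plaquette function `½Σi[A″, A″]`. [cite: Balaban1985Variational, (93) p.292; Balaban1985BackgroundPropagators, (3.9) p.392] -/
def fd93 (η : ℝ) (A : ι → S → 𝔸) : ι → S → 𝔸 :=
  divPη T U η ((2 : ℂ)⁻¹ • icomm T U A)

omit [Fintype S] in
/-- Unfolding: `fd93 = D*(½·icomm)`, and `D*` commutes with the `½`. [cite: Balaban1985Variational, (93) p.292] -/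
theorem fd93_apply (η : ℝ) (A : ι → S → 𝔸) (μ : ι) (x : S) :
    fd93 T U η A μ x = (2 : ℂ)⁻¹ • divPη T U η (icomm T U A) μ x := by
  rw [fd93, divPη, divPη, divP_smul, smul_comm]

/-- **(92) → (93), THE INTEGRATION BY PARTS** — «We transform the first term integrating by parts, and we get the functional derivative
given by ½D*Σi[A″, A″]»: `½⟨DδA′, Σi[A″, A″]⟩ = ⟨δA′, ½D*Σi[A″, A″]⟩` in the bond pairing (3.11), for every variation `δA′` — [5] (3.9)
(`B9Eq39Adjoint.bondPair_divPη`) at the plaquette function `½Σi[A″, A″]`; `τ` tracial. [cite: Balaban1985Variational, (92)-(93) p.292;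
Balaban1985BackgroundPropagators, (3.9) p.392] -/
theorem byParts_92_93 (τ : 𝔸 →ₗ[ℂ] ℂ) (hτ : ∀ a b : 𝔸, τ (a * b) = τ (b * a)) (η : ℝ) (d : ℕ) (A δ : ι → S → 𝔸) :
    (2 : ℂ)⁻¹ * plaqPair η d τ (curlη T U η δ) (icomm T U A) = bondPair η d τ δ (fd93 T U η A) := by
  rw [fd93, bondPair_divPη T U τ hτ η d δ, plaqPair, ← mul_assoc, mul_comm ((2 : ℂ)⁻¹), mul_assoc, Finset.mul_sum]
  refine congrArg _ (Finset.sum_congr rfl fun q _ => ?_)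
  rw [Pi.smul_apply, Pi.smul_apply, Pi.smul_apply, mul_smul_comm, map_smul, smul_eq_mul]

end ByParts

section Assembled

variable {𝔸 : Type*} [NormedRing 𝔸] [NormedAlgebra ℂ 𝔸] {S : Type*} [Fintype S] {ι : Type*} [Fintype ι] [LinearOrder ι]
variable (T : ι → Equiv.Perm S) (U : ι → S → 𝔸ˣ)

/-- **(91) → (92) → (93) assembled**: the derivative of the typical term along `δA′` is `⟨δA′, ½D*Σi[A″, A″]⟩` (the first term, by parts)
plus the second-and-third term `½⟨DA′, Σi([δA″, A″] + [A″, δA″])⟩`. [cite: Balaban1985Variational, (91)-(93) p.292] -/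
theorem hasDerivAt_T91_byParts (τ : 𝔸 →L[ℂ] ℂ) (hτ : ∀ a b : 𝔸, τ (a * b) = τ (b * a)) (η : ℝ) (d : ℕ) (A δ : ι → S → 𝔸) :
    HasDerivAt (fun t : ℂ => T91 T U η d (τ : 𝔸 →ₗ[ℂ] ℂ) (A + t • δ))
      (bondPair η d (τ : 𝔸 →ₗ[ℂ] ℂ) δ (fd93 T U η A) +
        (2 : ℂ)⁻¹ * plaqPair η d (τ : 𝔸 →ₗ[ℂ] ℂ) (curlη T U η A) (icommD T U A δ)) 0 := by
  rw [← byParts_92_93 T U (τ : 𝔸 →ₗ[ℂ] ℂ) hτ η d A δ]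
  exact hasDerivAt_T91 T U η d τ A δ

/-! ## §5 «estimated easily by O(1)|DA′||A′|» — the second and third terms per plaquette -/

omit [Fintype S] [Fintype ι] [LinearOrder ι] in
/-- `‖Σ_{b₁≺b₂} i([δA″, A″] + [A″, δA″])‖ ≤ 24·a·Δ` from letter bounds `‖A″(bᵢ)‖ ≤ a`, `‖δA″(bᵢ)‖ ≤ Δ` (6 pairs, 2 commutators each,
`‖[X, Y]‖ ≤ 2‖X‖‖Y‖`). [cite: Balaban1985Variational, (92) p.292] -/
theorem norm_icommD_le {A δ : ι → S → 𝔸} {μ ν : ι} {x : S} {a Δ : ℝ}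
    (h₁ : ‖ℓ₁ T U A μ ν x‖ ≤ a) (h₂ : ‖ℓ₂ A μ ν x‖ ≤ a) (h₃ : ‖ℓ₃ A μ ν x‖ ≤ a) (h₄ : ‖ℓ₄ T U A μ ν x‖ ≤ a)
    (k₁ : ‖ℓ₁ T U δ μ ν x‖ ≤ Δ) (k₂ : ‖ℓ₂ δ μ ν x‖ ≤ Δ) (k₃ : ‖ℓ₃ δ μ ν x‖ ≤ Δ) (k₄ : ‖ℓ₄ T U δ μ ν x‖ ≤ Δ) :
    ‖icommD T U A δ μ ν x‖ ≤ 24 * a * Δ := by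
  have hI : ‖(I : ℂ)‖ = 1 := by simp
  rw [icommD, norm_smul, hI, one_mul, comm2pol]
  have e12 := norm_lie_le_of_le k₁ h₂; have f12 := norm_lie_le_of_le h₁ k₂
  have e13 := norm_lie_le_of_le k₁ h₃; have f13 := norm_lie_le_of_le h₁ k₃
  have e14 := norm_lie_le_of_le k₁ h₄; have f14 := norm_lie_le_of_le h₁ k₄
  have e23 := norm_lie_le_of_le k₂ h₃; have f23 := norm_lie_le_of_le h₂ k₃
  have e24 := norm_lie_le_of_le k₂ h₄; have f24 := norm_lie_le_of_le h₂ k₄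
  have e34 := norm_lie_le_of_le k₃ h₄; have f34 := norm_lie_le_of_le h₃ k₄
  have t1 := (norm_add_le _ _).trans (add_le_add e12 f12)
  have t2 := (norm_add_le _ _).trans (add_le_add e13 f13)
  have t3 := (norm_add_le _ _).trans (add_le_add e14 f14)
  have t4 := (norm_add_le _ _).trans (add_le_add e23 f23)
  have t5 := (norm_add_le _ _).trans (add_le_add e24 f24)
  have t6 := (norm_add_le _ _).trans (add_le_add e34 f34)
  have s := (norm_add_le _ _).trans (add_le_add ((norm_add_le _ _).trans (add_le_add ((norm_add_le _ _).trans (add_le_add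
    ((norm_add_le _ _).trans (add_le_add ((norm_add_le _ _).trans (add_le_add t1 t2)) t3)) t4)) t5)) t6)
  linarith

omit [Fintype S] [Fintype ι] [LinearOrder ι] in
/-- **The second-plus-third-term summand per plaquette is `O(1)|DA′||A′|·|δA′|`** with the O(1) explicit:
`‖½τ((DA′)(p)·Σi([δA″, A″] + [A″, δA″]))‖ ≤ 12‖τ‖·G·a·Δ` for `‖(DA′)(p)‖ ≤ G` and the letter bounds of `norm_icommD_le`.
[cite: Balaban1985Variational, (92) p.292] -/
theorem norm_summand92_le (τ : 𝔸 →L[ℂ] ℂ) (η : ℝ) {A δ : ι → S → 𝔸} {μ ν : ι} {x : S} {a Δ G : ℝ} (hG0 : 0 ≤ G)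
    (hG : ‖curlη T U η A μ ν x‖ ≤ G)
    (h₁ : ‖ℓ₁ T U A μ ν x‖ ≤ a) (h₂ : ‖ℓ₂ A μ ν x‖ ≤ a) (h₃ : ‖ℓ₃ A μ ν x‖ ≤ a) (h₄ : ‖ℓ₄ T U A μ ν x‖ ≤ a)
    (k₁ : ‖ℓ₁ T U δ μ ν x‖ ≤ Δ) (k₂ : ‖ℓ₂ δ μ ν x‖ ≤ Δ) (k₃ : ‖ℓ₃ δ μ ν x‖ ≤ Δ) (k₄ : ‖ℓ₄ T U δ μ ν x‖ ≤ Δ) :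
    ‖(2 : ℂ)⁻¹ * (τ : 𝔸 →ₗ[ℂ] ℂ) (curlη T U η A μ ν x * icommD T U A δ μ ν x)‖ ≤ 12 * ‖τ‖ * G * a * Δ := by
  have hD := norm_icommD_le T U h₁ h₂ h₃ h₄ k₁ k₂ k₃ k₄
  have hprod : ‖curlη T U η A μ ν x * icommD T U A δ μ ν x‖ ≤ G * (24 * a * Δ) :=
    (norm_mul_le _ _).trans (mul_le_mul hG hD (norm_nonneg _) hG0)
  have hτ : ‖(τ : 𝔸 →ₗ[ℂ] ℂ) (curlη T U η A μ ν x * icommD T U A δ μ ν x)‖ ≤ ‖τ‖ * (G * (24 * a * Δ)) :=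
    (τ.le_opNorm _).trans (mul_le_mul_of_nonneg_left hprod (norm_nonneg _))
  have h2 : ‖(2 : ℂ)⁻¹‖ = 2⁻¹ := by simp
  rw [norm_mul, h2]
  nlinarith [norm_nonneg τ, hτ]

end Assembled

end Literature.MathematicalPhysics.QuantumFieldTheory.Balaban1983to89.B11Eq92ByParts
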